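/-
COR-CM (cell pub-hodgecm2) — Δ2 ORIENTATION RE-KEY, hΘ′ DISCHARGE ROUTE 2 of 2 (SYMMETRY-OF-PROOF): THE KERNEL FORM OF THE ASYMMETRY.
Seat d2bridge-htheta-2 g0 (prover-pub-hodgecm2-d2bridge-htheta-2-g0-0), 2026-08-23.  NEW additive KERNEL leaf; imports LANDED tree modules
only (`HodgeCM.Model.HThetaJunctionR2B` = the supply of record ✔ `SInstance.hJ_ROGT'C_block`, `HodgeCM.Model.Binders.JLiuLineTypeScale`);
namespaces `HodgeCM.Rekey.SignRecipe` ∕ `HodgeCM.Model.Rekey.LiuIndex` ∕ `HodgeCM.Model.Rekey.SInstance` (new names, nothing re-declared).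
KERNEL ONLY: theorems; 0 defs, 0 `def … : Prop`, nothing cited, no `sorry`.
FRAMING: HC_CM is NOT proved; «Δ2 BRIDGE CLOSED» is NOT claimed; HELD pending orientation re-key ∕ the 01:00Z fork (DECISION #18 (F)).
-/
import Summits.HodgeConjecture.HodgeCM.Model.HThetaJunctionR2B
import Summits.HodgeConjecture.HodgeCM.Model.Binders.JLiuLineTypeScale

set_option autoImplicit false

/-!
# hΘ′ (`Rekey.SInstance.HThetaAnti`) — is the PROOF of the supply of record symmetric under `z z̄ · a_i ↦ −(z z̄ · a_i)`?  NO.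

The supply of record ✔ `SInstance.hJ_ROGT'C_block` (`HThetaJunctionR2B.lean` :270) is, slot by slot, `hJ_slot_k_block_of_lineRepOf`
(`HThetaBlockSlots01 ∕ 23`), whose two load-bearing steps are

* **(I) the index, ON THE NOSE** — `LiuIndex.I.exists_line_eq_twistBy_bigCharOfV_of_eq V μ (repAt_mk_self a_k) hGR_k … hμ`: an index `j`
  over the class `⟦a_k⟧` with `line j = splitLine_kTwistedG` and `(line j).scalar = a_k` EXACTLY (`z := 1`, `exists_isometric_of_line_eq`);
  its input `hμ : muLiu ι₁ rep ⟦a_k⟧ = charArchType (c_V ∘ centre_∞) + centralTypeOf V a_k hGR_k` is discharged by (CC)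
  (`muLiu_mk_eq_add_ROGT'C_k`) BECAUSE `ι₁ ∈ Φ^δ(a_k)` at a good context of the bit of record (`GoodCtx.self_mem_lineType hc.2 k`), i.e.
  because the table value is `−𝟙_{w₁}` (the `H^{1,0}` value);
* **(B) the block clause** — `mem_block_pin_of_line_eq_of_mem_biSup … hline … dictEquiv_kCanonicalG`: the tower vector of a theta class lies
  in the isotypic sum of the pin datum's `coinvRep χ`, which IS (`dictEquiv_kCanonicalG`) the Weil module `(splitLine_k).Ω (ιVE V) χ″` of
  the slot line `⟨a_k⟩` — the line that is POSITIVE at `ι₁` (`eR : PosIdx ≃ Unit`, `eS : NegIdx ≃ Empty`, the holomorphic K-type row `hχ`).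

Both steps are keyed to the Gram class `⟦a_k⟧`.  This file proves, in the kernel, what the index swap does to them:

* § 0 `Φ^δ(−(z z̄ · a)) = (Φ^δ(a))ᶜ` (`Rekey.SignRecipe.mem_lineType_neg_mul_conj_mul_iff`) and `−(z z̄ · a) ≠ w w̄ · a`
  (`neg_mul_conj_mul_ne_mul_conj_mul`: `−1` is not a hermitian norm);
* § 1 for ANY index `j′` of the pinned family at `a₀` with `(line j′).scalar = −(z z̄ · a₀)`: its class is NOT `⟦a₀⟧`
  (`Rekey.LiuIndex.cls_ne_mk_of_antiIsometric`), `ι₁ ∉ Φ^δ(scalar j′)` when `ι₁ ∈ Φ^δ(a₀)`, its table value is `+𝟙_{w₁}` — the `H^{0,1}`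
  value (`muLiu_cls_of_antiIsometric`, against `muLiu_mk_of_mem … = −𝟙_{w₁}` at `⟦a₀⟧`), its splitting HAS central type `+𝟙_{w₁}`
  (`hasCentralTypeAt_placeIndicator_of_antiIsometric`), and its line differs from every isometric index line (`line_ne_of_antiIsometric`).
  So step (I) has NO twin inside the pin's inputs: (CC) produces type `−𝟙_{w₁}` for every `bigCharOfV`-twist of every record `ofCMOf … hGR`,
  never `+𝟙_{w₁}` — a compatible pair splitting of central type `+𝟙_{w₁}` at the mirror scalar is an input the pin does not have
  (UNPROVED in the tree; true in nature);
* § 2 AT THE R2 PIN (`SROGT'C`, guard `GOG V c`): the displayed `hΘ′` at `(V, c, i)` — stated here over the LIVE pin, to which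
  `Rekey.SInstance.HThetaAnti … V c i` unfolds by `Rekey.liuDictionaryPin_block ∕ _H` (`rfl`) — TOGETHER WITH the supply of record gives, for
  every theta class `ω` of slot `i` at every level below conj-three, TWO tower lifts `cf`, `cf′` of the SAME `ω` in the blocks of two indices
  `j ≠ j′` with DIFFERENT lines and COMPLEMENTARY `w₁`-types `−𝟙_{w₁}` ∕ `+𝟙_{w₁}` (`Rekey.SInstance.two_lifts_of_hThetaAnti`).  This is the
  exact input of the T5 consistency test (mc-theta-3 g59, STATUS 22:34Z): with block separation for distinct lines (`Prop413 ∧ MuSeparated`,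
  [Liu21, Prop. 4.13 + Lem. D.1 (3)]) the two lifts can agree only modulo `ker res`; step (B) therefore has no twin either — a
  `ℂ[U(V)(𝔸_f)]`-surjection `Ω(⟨−a_k⟩-line, χ′) ↠ coinvRep χ` is FALSE in nature for a non-zero class (different local theta lifts,
  [GR91] `π^n` vs `π^s`; Hodge types `(1,0)` vs `(0,1)`), while in the tree it is neither provable (no anti-isometric membership theorem exists)
  nor refutable (`block j′` quantifies over abstract module maps into the tower; non-vanishing of one theta class is not a tree theorem).
VERDICT OF THE ROUTE: the proof is NOT symmetric; `hΘ′` has no twin theorem; what any discharge must supply is named by § 1 ∕ § 2.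
All `[folklore]`.
-/

noncomputable section

open NumberField NumberField.InfinitePlace NumberField.mixedEmbedding IsDedekindDomain
open scoped Matrix Classical TensorProduct SchwartzMap
open MulAction
open Literature.Geometry.ComplexHyperbolic.BallModel (U21 x₀ stabilizerEquivK21)
open Literature.NumberTheory.Automorphic.U21 (K21 matA sclD)
open Literature.AlgebraicGeometry.ShimuraVarieties Literature.AlgebraicGeometry.ShimuraVarieties.BallForms
open Literature.AlgebraicGeometry.HodgeTheory Literature.NumberTheory.Automorphic.PicardCM
open Literature.NumberTheory.Transcendental (Arapura2012_Cor_15_4_6)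
open Literature.NumberTheory.Automorphic Literature.NumberTheory.Automorphic.UnitaryGroup Literature.NumberTheory.Weil1964
open Literature.NumberTheory.GelbartRogawski1991 Literature.NumberTheory.GelbartRogawski1991.UnitaryDualPair
open HodgeCM.Adelic HodgeCM.PerL34 HodgeCM.Model.HypCensus HodgeCM.Model.SupplyInstance HodgeCM.Model.ArchSideTerm
open HodgeCM.Model.ThetaSpace HodgeCM.Model.TowerLevel HodgeCM.Model.TowerCarrier HodgeCM.Literature.Theta

/-! ## § 0  The mirror scalar: `Φ^δ(−(z z̄ · a))` is the complementary type, and `−(z z̄ · a)` is never `w w̄ · a` -/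

namespace HodgeCM.Rekey.SignRecipe

open HodgeCM HodgeCM.SignRecipe

variable {L : CMField}

/-- `−(z z̄)` is totally real. [folklore] -/
theorem conj_neg_mul_conj (z : L) : conjRingHomK L (-(z * conjRingHomK L z)) = -(z * conjRingHomK L z) := by
  rw [map_neg, conj_mul_conj_self]

/-- `−(z z̄ · a)` is totally real for `a` totally real. [folklore] -/
theorem conj_neg_mul_conj_mul (z : L) {a : L} (ha : conjRingHomK L a = a) :
    conjRingHomK L (-(z * conjRingHomK L z * a)) = -(z * conjRingHomK L z * a) := by
  rw [map_neg, map_mul, conj_mul_conj_self, ha]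

/-- `−(z z̄ · a) ≠ 0` for `z, a ≠ 0`. [folklore] -/
theorem neg_mul_conj_mul_ne_zero {z a : L} (hz : z ≠ 0) (ha0 : a ≠ 0) : -(z * conjRingHomK L z * a) ≠ 0 :=
  neg_ne_zero.2 (mul_ne_zero (mul_ne_zero hz ((map_ne_zero _).2 hz)) ha0)

/-- **`Φ^δ(−(z z̄ · a)) = (Φ^δ(a))ᶜ`**: the mirror line has the COMPLEMENTARY δ-positive type (`Re τ(−z z̄) = −|τ z|² < 0` flips the sign of
`Im τ(η · a)`, which is never `0`). [folklore] -/
theorem mem_lineType_neg_mul_conj_mul_iff {z a : L} (hz : z ≠ 0) (ha : conjRingHomK L a = a) (ha0 : a ≠ 0)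
    (hb : conjRingHomK L (-(z * conjRingHomK L z * a)) = -(z * conjRingHomK L z * a)) (hb0 : -(z * conjRingHomK L z * a) ≠ 0)
    (τ : L →+* ℂ) :
    τ ∈ (lineType (-(z * conjRingHomK L z * a)) hb hb0).1 ↔ τ ∉ (lineType a ha ha0).1 := by
  rw [mem_lineType_iff, mem_lineType_iff, not_lt,
    show eta L * -(z * conjRingHomK L z * a) = eta L * (-(z * conjRingHomK L z) * a) by ring,
    im_embedding_eta_mul_mul (conj_neg_mul_conj z) a τ]
  have hneg : (τ (-(z * conjRingHomK L z))).re < 0 := by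
    rw [map_neg, Complex.neg_re, neg_lt_zero]
    exact re_embedding_mul_conj_self_pos hz τ
  have hne : (τ (eta L * a)).im ≠ 0 := by
    rw [im_embedding_eta_mul]
    exact mul_ne_zero (embedding_eta_im_ne_zero L τ) (re_embedding_ne_zero_of_conj_eq ha ha0 τ)
  constructor
  · intro h
    by_contra hlt
    exact (lt_irrefl (0 : ℝ)) (h.trans (mul_neg_of_neg_of_pos hneg (not_le.1 hlt)))
  · intro hle
    exact mul_pos_of_neg_of_neg hneg (lt_of_le_of_ne hle hne)

/-- **`−1` is not a hermitian norm**: `−(z z̄ · a) ≠ w w̄ · a` for `z, a ≠ 0` (read through any complex embedding `τ`: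
`−|τ z|² = |τ w|²` is absurd). [folklore] -/
theorem neg_mul_conj_mul_ne_mul_conj_mul (τ : L →+* ℂ) {z a : L} (w : L) (hz : z ≠ 0) (ha0 : a ≠ 0) :
    -(z * conjRingHomK L z * a) ≠ w * conjRingHomK L w * a := by
  intro h
  have h' : -(z * conjRingHomK L z) = w * conjRingHomK L w :=
    mul_right_cancel₀ ha0 (by rw [neg_mul, h])
  have hzpos : 0 < (τ (z * conjRingHomK L z)).re := re_embedding_mul_conj_self_pos hz τ
  have hw : 0 ≤ (τ (w * conjRingHomK L w)).re := by
    rw [map_mul, embedding_conjRingHomK, Complex.mul_conj, Complex.ofReal_re]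
    exact Complex.normSq_nonneg _
  have hre := congrArg (fun x : L => (τ x).re) h'
  simp only [map_neg, Complex.neg_re] at hre
  linarith

end HodgeCM.Rekey.SignRecipe

/-! ## § 1  Any ANTI-isometric index of the pinned family is of the complementary `w₁`-type -/

namespace HodgeCM.Model.Rekey.LiuIndex

open HodgeCM HodgeCM.SignRecipe HodgeCM.Rekey.SignRecipe HodgeCM.Model HodgeCM.Model.LiuIndex

variable {L : CMField} {ι₁ : (L : Type) →+* ℂ} (V : HermSpace3 L ι₁) (a₀ : RealScalar L)
  (μ : GramClass L → InfinitePlace (L : Type) → ℤ)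

/-- the Gram scalar of an index of the family pointed at `a₀` is the representative of its class (`line_scalar`, `scalar_def`). [folklore] -/
theorem repAt_cls_val_eq_of_scalar_eq (j : I V (repAt a₀) μ) {b : (L : Type)} (h : (line V (repAt a₀) μ j).scalar = b) :
    (repAt a₀ j.1).1 = b :=
  ((line_scalar V (repAt a₀) μ j).symm.trans h :)

/-- **an anti-isometric index is NOT over the class `⟦a₀⟧`** (the supply's index is: `line_isometric_iff`). [folklore] -/
theorem cls_ne_mk_of_antiIsometric (j : I V (repAt a₀) μ) {z : (L : Type)} (hz : z ≠ 0)
    (h : (line V (repAt a₀) μ j).scalar = -(z * conjRingHomK L z * a₀.1)) : j.1 ≠ GramClass.mk a₀ := by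
  intro hj
  obtain ⟨w, -, hw⟩ := (line_isometric_iff V (mk_repAt a₀) μ j a₀).2 hj
  exact neg_mul_conj_mul_ne_mul_conj_mul ι₁ w hz a₀.2.2 (h.symm.trans hw)

/-- **`ι₁ ∉ Φ^δ(scalar j′)`** for an anti-isometric index `j′` whenever `ι₁ ∈ Φ^δ(a₀)` (the slot case: `GoodCtx.self_mem_lineType`). [folklore] -/
theorem not_mem_lineType_of_antiIsometric (j : I V (repAt a₀) μ) {z : (L : Type)} (hz : z ≠ 0)
    (h : (line V (repAt a₀) μ j).scalar = -(z * conjRingHomK L z * a₀.1)) (hι : ι₁ ∈ (lineType a₀.1 a₀.2.1 a₀.2.2).1) :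
    ι₁ ∉ (lineType (repAt a₀ j.1).1 (repAt a₀ j.1).2.1 (repAt a₀ j.1).2.2).1 := by
  rw [lineType_congr (repAt_cls_val_eq_of_scalar_eq V a₀ μ j h) (repAt a₀ j.1).2.1 (repAt a₀ j.1).2.2
      (conj_neg_mul_conj_mul z (RealScalar.conj_val a₀)) (neg_mul_conj_mul_ne_zero hz a₀.2.2),
    mem_lineType_neg_mul_conj_mul_iff hz (RealScalar.conj_val a₀) a₀.2.2, not_not]
  exact hι

/-- **THE TABLE VALUE OF AN ANTI-ISOMETRIC INDEX IS `+𝟙_{w₁}`** (the `H^{0,1}` value of [Liu21, Prop. 4.13]) for EVERY section `ρ′` of `mk`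
(the pin's recipe of record reads `ρ′ := GramClass.rep`), as soon as `ι₁ ∈ Φ^δ(a₀)`; compare `muLiu_mk_of_mem … : muLiu ι₁ ρ′ ⟦a₀⟧ = −𝟙_{w₁}`,
the value (CC) delivers to the supply's step (I). [folklore] -/
theorem muLiu_cls_of_antiIsometric (ρ' : GramClass L → RealScalar L) (hρ' : ∀ q, GramClass.mk (ρ' q) = q)
    (j : I V (repAt a₀) μ) {z : (L : Type)} (hz : z ≠ 0)
    (h : (line V (repAt a₀) μ j).scalar = -(z * conjRingHomK L z * a₀.1)) (hι : ι₁ ∈ (lineType a₀.1 a₀.2.1 a₀.2.2).1) :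
    muLiu ι₁ ρ' j.1 = placeIndicator ι₁ := by
  rw [← mk_repAt a₀ j.1]
  exact muLiu_mk_of_not_mem hρ' (repAt a₀ j.1) (not_mem_lineType_of_antiIsometric V a₀ μ j hz h hι)

/-- … hence DIFFERENT from the table value at the slot class `⟦a₀⟧` (`−𝟙_{w₁} ≠ +𝟙_{w₁}`). [folklore] -/
theorem muLiu_cls_ne_muLiu_mk_of_antiIsometric (ρ' : GramClass L → RealScalar L) (hρ' : ∀ q, GramClass.mk (ρ' q) = q)
    (j : I V (repAt a₀) μ) {z : (L : Type)} (hz : z ≠ 0)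
    (h : (line V (repAt a₀) μ j).scalar = -(z * conjRingHomK L z * a₀.1)) (hι : ι₁ ∈ (lineType a₀.1 a₀.2.1 a₀.2.2).1) :
    muLiu ι₁ ρ' j.1 ≠ muLiu ι₁ ρ' (GramClass.mk a₀) := by
  rw [muLiu_cls_of_antiIsometric V a₀ μ ρ' hρ' j hz h hι, muLiu_mk_of_mem hρ' a₀ hι]
  intro hcontra
  have h1 := congrFun hcontra (cmPlaceOver (L : Type) (HypCensus.cmPlace (L : Type) ι₁)).1
  simp only [Pi.neg_apply, Pi.single_eq_same] at h1
  omega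

/-- **the splitting of an anti-isometric index of the recipe-of-record family HAS central type `+𝟙_{w₁}`** — the archimedean type the supply's
(CC) identity never produces (`centralTypeOfTwist … = −𝟙_{w₁}`, `LiuIndexMuLiu` § 4). [folklore] -/
theorem hasCentralTypeAt_placeIndicator_of_antiIsometric (ρ' : GramClass L → RealScalar L) (hρ' : ∀ q, GramClass.mk (ρ' q) = q)
    (j : I V (repAt a₀) (muLiu ι₁ ρ')) {z : (L : Type)} (hz : z ≠ 0)
    (h : (line V (repAt a₀) (muLiu ι₁ ρ') j).scalar = -(z * conjRingHomK L z * a₀.1)) (hι : ι₁ ∈ (lineType a₀.1 a₀.2.1 a₀.2.2).1) :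
    HasCentralTypeAt V (repAt a₀ j.1) j.2.1 (placeIndicator ι₁) := by
  have hj := hasCentralTypeAt_of_mem V (repAt a₀) (muLiu ι₁ ρ') j
  rwa [mk_repAt, muLiu_cls_of_antiIsometric V a₀ (muLiu ι₁ ρ') ρ' hρ' j hz h hι] at hj

/-- **an anti-isometric index line differs from every isometric one** (their Gram scalars differ), and so do their classes. [folklore] -/
theorem line_ne_of_antiIsometric (j j₀ : I V (repAt a₀) μ) {z : (L : Type)} (hz : z ≠ 0)
    (h : (line V (repAt a₀) μ j).scalar = -(z * conjRingHomK L z * a₀.1))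
    (h₀ : ∃ w : (L : Type), w ≠ 0 ∧ (line V (repAt a₀) μ j₀).scalar = w * conjRingHomK L w * a₀.1) :
    line V (repAt a₀) μ j ≠ line V (repAt a₀) μ j₀ ∧ j.1 ≠ j₀.1 := by
  obtain ⟨w, hw0, hw⟩ := h₀
  have hj₀ : j₀.1 = GramClass.mk a₀ := (line_isometric_iff V (mk_repAt a₀) μ j₀ a₀).1 ⟨w, hw0, hw⟩
  refine ⟨fun hl => ?_, fun hc => cls_ne_mk_of_antiIsometric V a₀ μ j hz h (hc.trans hj₀)⟩
  exact neg_mul_conj_mul_ne_mul_conj_mul ι₁ w hz a₀.2.2 (h.symm.trans ((congrArg (fun p => p.scalar) hl).trans hw))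

end HodgeCM.Model.Rekey.LiuIndex

/-! ## § 2  At the R2 pin: `hΘ′` + the supply of record = two lifts of every theta class in blocks of complementary `w₁`-type -/

namespace HodgeCM.Model.Rekey.SInstance

open HodgeCM.Model HodgeCM.Model.SInstance HodgeCM.Model.ThetaAdelicSide HodgeCM.Model.LiuIndex
open HodgeCM.Model.Rekey.LiuIndex

variable (hHD : exists_isReal_hodgeModel) (hI : hodgePQ_independent_of_hodgeModel)
  (h₁ : BallQuotientUniformised) (h₃ : CMAbelianVarietyRealised) (hA : Arapura2012_Cor_15_4_6)

variable
  (hGR : ∀ {L : CMField} {ι₁ : L →+* ℂ} (V : HermSpace3 L ι₁) (c : SeesawCtx L),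
    (cmSplittingDatum (L : Type) finProdFinEquiv (frameD V) (frameD_real V) (frameD_ne V) (dW c.D) (dW_real c.D)
      (dW_ne c.D)).CompatibleSplitting)
  (hGR₀ : ∀ {L : CMField} {ι₁ : L →+* ℂ} (V : HermSpace3 L ι₁) (c : SeesawCtx L),
    (cmSplittingDatum (L : Type) (e₁) (frameD V) (frameD_real V) (frameD_ne V) (lineVec (L : Type) (dW c.D 0))
      (fun _ => dW_real c.D 0) (fun _ => dW_ne c.D 0)).CompatibleSplitting)
  (hGR₁ : ∀ {L : CMField} {ι₁ : L →+* ℂ} (V : HermSpace3 L ι₁) (c : SeesawCtx L),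
    (cmSplittingDatum (L : Type) (e₁) (frameD V) (frameD_real V) (frameD_ne V) (lineVec (L : Type) (dW c.D 1))
      (fun _ => dW_real c.D 1) (fun _ => dW_ne c.D 1)).CompatibleSplitting)
  (hGR₂ : ∀ {L : CMField} {ι₁ : L →+* ℂ} (V : HermSpace3 L ι₁) (c : SeesawCtx L),
    (cmSplittingDatum (L : Type) (e₁) (frameD V) (frameD_real V) (frameD_ne V) (lineVec (L : Type) (dW' c.D 0))
      (fun _ => dW'_real c.D 0) (fun _ => dW'_ne c.D 0)).CompatibleSplitting)
  (hGR₃ : ∀ {L : CMField} {ι₁ : L →+* ℂ} (V : HermSpace3 L ι₁) (c : SeesawCtx L),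
    (cmSplittingDatum (L : Type) (e₁) (frameD V) (frameD_real V) (frameD_ne V) (lineVec (L : Type) (dW' c.D 1))
      (fun _ => dW'_real c.D 1) (fun _ => dW'_ne c.D 1)).CompatibleSplitting)
  (μ : ∀ {L : CMField}, SeesawCtx L → Fin 4 → NumberField.InfinitePlace (L : Type) → ℤ)
  (hΔ₁ : ∀ {L : CMField} {ι₁ : L →+* ℂ} (V : HermSpace3 L ι₁) (c : SeesawCtx L), ∀ hc : GOG V c,
    slotTypeVec V c (hGR V c) (hGR₀ V c) (hGR₁ V c) (hGR₂ V c) (hGR₃ V c) (hG_GOG V c hc) 1 -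
      slotTypeVec V c (hGR V c) (hGR₀ V c) (hGR₁ V c) (hGR₂ V c) (hGR₃ V c) (hG_GOG V c hc) 0 = μ c 1 - μ c 0)
  (hΔ₂ : ∀ {L : CMField} {ι₁ : L →+* ℂ} (V : HermSpace3 L ι₁) (c : SeesawCtx L), ∀ hc : GOG V c,
    slotTypeVec V c (hGR V c) (hGR₀ V c) (hGR₁ V c) (hGR₂ V c) (hGR₃ V c) (hG_GOG V c hc) 2 -
      slotTypeVec V c (hGR V c) (hGR₀ V c) (hGR₁ V c) (hGR₂ V c) (hGR₃ V c) (hG_GOG V c hc) 0 = μ c 2 - μ c 0)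
  (hΔ₃ : ∀ {L : CMField} {ι₁ : L →+* ℂ} (V : HermSpace3 L ι₁) (c : SeesawCtx L), ∀ hc : GOG V c,
    slotTypeVec V c (hGR V c) (hGR₀ V c) (hGR₁ V c) (hGR₂ V c) (hGR₃ V c) (hG_GOG V c hc) 3 -
      slotTypeVec V c (hGR V c) (hGR₀ V c) (hGR₁ V c) (hGR₂ V c) (hGR₃ V c) (hG_GOG V c hc) 0 = μ c 3 - μ c 0)

variable {L : CMField} {ι₁ : L →+* ℂ} (V : HermSpace3 L ι₁) (c : SeesawCtx L)

/-- **`hΘ′` + THE SUPPLY OF RECORD ⇒ TWO LIFTS OF EVERY THETA CLASS IN BLOCKS OF COMPLEMENTARY `w₁`-TYPE.**  At the R2 pin `SROGT'C` under the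
guard `GOG V c` (and `V` anisotropic), let `hΘ` be the displayed fifth hypothesis AT `(V, c, i)` — `Rekey.SInstance.HThetaAnti … V c i`
written over the live pin (same blocks: `Rekey.liuDictionaryPin_block`, `rfl`): an ANTI-isometric index `j′` whose block holds a lift of every
slot-`i` theta class.  Then, with the ISOMETRIC index `j` of ✔ `SInstance.hJ_ROGT'C_block`: `line j ≠ line j′`, `j.1 ≠ j′.1`, the recipe of
record reads `−𝟙_{w₁}` at `j` and `+𝟙_{w₁}` at `j′` (`H^{1,0}` vs `H^{0,1}` value), the splitting of `j′` has central type `+𝟙_{w₁}`, and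
every theta class `ω` has a lift `cf` in `block j` AND a lift `cf′` in `block j′` (equal only modulo `ker res`).  The T5 test's exact input;
nothing here asserts `hΘ′`. [folklore] -/
theorem two_lifts_of_hThetaAnti (hc : GOG V c) (hV : IsAnisotropic L V.Hm) (i : Fin 4)
    (hΘ : ∃ j' : LiuIndex.I V (LiuIndex.repAt (⟨c.D.a i, c.D.a_real i, c.D.a_ne i⟩ : LiuIndex.RealScalar L))
        (muLiu ι₁ LiuIndex.GramClass.rep),
      (∃ z : (L : Type), z ≠ 0 ∧
        (LiuIndex.line V (LiuIndex.repAt (⟨c.D.a i, c.D.a_real i, c.D.a_ne i⟩ : LiuIndex.RealScalar L))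
          (muLiu ι₁ LiuIndex.GramClass.rep) j').scalar = -(z * conjRingHomK L z * c.D.a i)) ∧
      ∀ (Γ : Level V) (hΓ : Γ.BelowConjThree),
        ∀ ω ∈ thetaOf _ (thetaClassInputOf _ (fun V c => thetaSpaceInputOf hHD hI h₁ h₃
            (SROGT'C @hGR @hGR₀ @hGR₁ @hGR₂ @hGR₃ @μ hΔ₁ hΔ₂ hΔ₃) V c)) V c i Γ,
          ∃ cf : towerLevel hHD hI (ballQuotientUniformisedDatum_of h₁) h₃ hA Γ hΓ,
            TowerLevel.res hHD hI (ballQuotientUniformisedDatum_of h₁) h₃ hA cf = ω ∧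
              (ofLevel hHD hI (ballQuotientUniformisedDatum_of h₁) h₃ hA Γ hΓ cf :
                  (liuDictionaryPin hHD hI h₁ h₃ hA V
                    (LiuIndex.I V (LiuIndex.repAt (⟨c.D.a i, c.D.a_real i, c.D.a_ne i⟩ : LiuIndex.RealScalar L))
                      (muLiu ι₁ LiuIndex.GramClass.rep))
                    (LiuIndex.line V (LiuIndex.repAt (⟨c.D.a i, c.D.a_real i, c.D.a_ne i⟩ : LiuIndex.RealScalar L))
                      (muLiu ι₁ LiuIndex.GramClass.rep))).H) ∈
                (liuDictionaryPin hHD hI h₁ h₃ hA V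
                    (LiuIndex.I V (LiuIndex.repAt (⟨c.D.a i, c.D.a_real i, c.D.a_ne i⟩ : LiuIndex.RealScalar L))
                      (muLiu ι₁ LiuIndex.GramClass.rep))
                    (LiuIndex.line V (LiuIndex.repAt (⟨c.D.a i, c.D.a_real i, c.D.a_ne i⟩ : LiuIndex.RealScalar L))
                      (muLiu ι₁ LiuIndex.GramClass.rep))).block j') :
    ∃ j j' : LiuIndex.I V (LiuIndex.repAt (⟨c.D.a i, c.D.a_real i, c.D.a_ne i⟩ : LiuIndex.RealScalar L))
        (muLiu ι₁ LiuIndex.GramClass.rep),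
      (∃ z : (L : Type), z ≠ 0 ∧
        (LiuIndex.line V (LiuIndex.repAt (⟨c.D.a i, c.D.a_real i, c.D.a_ne i⟩ : LiuIndex.RealScalar L))
          (muLiu ι₁ LiuIndex.GramClass.rep) j).scalar = z * conjRingHomK L z * c.D.a i) ∧
      (∃ z : (L : Type), z ≠ 0 ∧
        (LiuIndex.line V (LiuIndex.repAt (⟨c.D.a i, c.D.a_real i, c.D.a_ne i⟩ : LiuIndex.RealScalar L))
          (muLiu ι₁ LiuIndex.GramClass.rep) j').scalar = -(z * conjRingHomK L z * c.D.a i)) ∧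
      LiuIndex.line V (LiuIndex.repAt (⟨c.D.a i, c.D.a_real i, c.D.a_ne i⟩ : LiuIndex.RealScalar L))
          (muLiu ι₁ LiuIndex.GramClass.rep) j' ≠
        LiuIndex.line V (LiuIndex.repAt (⟨c.D.a i, c.D.a_real i, c.D.a_ne i⟩ : LiuIndex.RealScalar L))
          (muLiu ι₁ LiuIndex.GramClass.rep) j ∧
      j'.1 ≠ j.1 ∧
      muLiu ι₁ LiuIndex.GramClass.rep j.1 = -placeIndicator ι₁ ∧
      muLiu ι₁ LiuIndex.GramClass.rep j'.1 = placeIndicator ι₁ ∧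
      LiuIndex.HasCentralTypeAt V
          (LiuIndex.repAt (⟨c.D.a i, c.D.a_real i, c.D.a_ne i⟩ : LiuIndex.RealScalar L) j'.1) j'.2.1 (placeIndicator ι₁) ∧
      ∀ (Γ : Level V) (hΓ : Γ.BelowConjThree),
        ∀ ω ∈ thetaOf _ (thetaClassInputOf _ (fun V c => thetaSpaceInputOf hHD hI h₁ h₃
            (SROGT'C @hGR @hGR₀ @hGR₁ @hGR₂ @hGR₃ @μ hΔ₁ hΔ₂ hΔ₃) V c)) V c i Γ,
          ∃ cf cf' : towerLevel hHD hI (ballQuotientUniformisedDatum_of h₁) h₃ hA Γ hΓ,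
            TowerLevel.res hHD hI (ballQuotientUniformisedDatum_of h₁) h₃ hA cf = ω ∧
            TowerLevel.res hHD hI (ballQuotientUniformisedDatum_of h₁) h₃ hA cf' = ω ∧
              (ofLevel hHD hI (ballQuotientUniformisedDatum_of h₁) h₃ hA Γ hΓ cf :
                  (liuDictionaryPin hHD hI h₁ h₃ hA V
                    (LiuIndex.I V (LiuIndex.repAt (⟨c.D.a i, c.D.a_real i, c.D.a_ne i⟩ : LiuIndex.RealScalar L))
                      (muLiu ι₁ LiuIndex.GramClass.rep))
                    (LiuIndex.line V (LiuIndex.repAt (⟨c.D.a i, c.D.a_real i, c.D.a_ne i⟩ : LiuIndex.RealScalar L))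
                      (muLiu ι₁ LiuIndex.GramClass.rep))).H) ∈
                (liuDictionaryPin hHD hI h₁ h₃ hA V
                    (LiuIndex.I V (LiuIndex.repAt (⟨c.D.a i, c.D.a_real i, c.D.a_ne i⟩ : LiuIndex.RealScalar L))
                      (muLiu ι₁ LiuIndex.GramClass.rep))
                    (LiuIndex.line V (LiuIndex.repAt (⟨c.D.a i, c.D.a_real i, c.D.a_ne i⟩ : LiuIndex.RealScalar L))
                      (muLiu ι₁ LiuIndex.GramClass.rep))).block j ∧
              (ofLevel hHD hI (ballQuotientUniformisedDatum_of h₁) h₃ hA Γ hΓ cf' :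
                  (liuDictionaryPin hHD hI h₁ h₃ hA V
                    (LiuIndex.I V (LiuIndex.repAt (⟨c.D.a i, c.D.a_real i, c.D.a_ne i⟩ : LiuIndex.RealScalar L))
                      (muLiu ι₁ LiuIndex.GramClass.rep))
                    (LiuIndex.line V (LiuIndex.repAt (⟨c.D.a i, c.D.a_real i, c.D.a_ne i⟩ : LiuIndex.RealScalar L))
                      (muLiu ι₁ LiuIndex.GramClass.rep))).H) ∈
                (liuDictionaryPin hHD hI h₁ h₃ hA V
                    (LiuIndex.I V (LiuIndex.repAt (⟨c.D.a i, c.D.a_real i, c.D.a_ne i⟩ : LiuIndex.RealScalar L))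
                      (muLiu ι₁ LiuIndex.GramClass.rep))
                    (LiuIndex.line V (LiuIndex.repAt (⟨c.D.a i, c.D.a_real i, c.D.a_ne i⟩ : LiuIndex.RealScalar L))
                      (muLiu ι₁ LiuIndex.GramClass.rep))).block j' := by
  obtain ⟨j, hj, hfam⟩ := hJ_ROGT'C_block hHD hI h₁ h₃ hA @hGR @hGR₀ @hGR₁ @hGR₂ @hGR₃ @μ hΔ₁ hΔ₂ hΔ₃ V c hc hV i
  obtain ⟨j', ⟨z, hz, hz'⟩, hfam'⟩ := hΘ
  have hι : ι₁ ∈ (SignRecipe.lineType (c.D.a i) (c.D.a_real i) (c.D.a_ne i)).1 :=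
    SignRecipe.GoodCtx.self_mem_lineType hc.2 i
  have hjcls : j.1 = LiuIndex.GramClass.mk ⟨c.D.a i, c.D.a_real i, c.D.a_ne i⟩ :=
    (LiuIndex.line_isometric_iff V (LiuIndex.mk_repAt _) _ j _).1 hj
  refine ⟨j, j', hj, ⟨z, hz, hz'⟩, (line_ne_of_antiIsometric V _ _ j' j hz hz' hj).1,
    (line_ne_of_antiIsometric V _ _ j' j hz hz' hj).2, ?_,
    muLiu_cls_of_antiIsometric V _ _ LiuIndex.GramClass.rep LiuIndex.GramClass.mk_rep j' hz hz' hι,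
    hasCentralTypeAt_placeIndicator_of_antiIsometric V _ LiuIndex.GramClass.rep LiuIndex.GramClass.mk_rep j' hz hz' hι,
    fun Γ hΓ ω hω => ?_⟩
  · rw [hjcls]
    exact LiuIndex.muLiu_mk_of_mem LiuIndex.GramClass.mk_rep _ hι
  · obtain ⟨cf, hcf, hmem⟩ := hfam Γ hΓ ω hω
    obtain ⟨cf', hcf', hmem'⟩ := hfam' Γ hΓ ω hω
    exact ⟨cf, cf', hcf, hcf', hmem, hmem'⟩

end HodgeCM.Model.Rekey.SInstance

end
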